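import Summits.ValiantsHypothesis.ValiantsHypothesis.Theorems.DivisionGapPerDivisionHardPerPowers

/-!
# Crux `DivisionGap.PerDivisionHard` (stmt-ValiantsHypothesis-5065), line
`pair-descent-jss-endpoint` — negative lemma `stub_translateCheap`: translates of `S_n` are cheap
inside a torus class (balancing junk)

The tempting support-translate conjecture "a torus-homogeneous `h` whose support contains a
translate `u + {μ_σ : σ ∈ S_n}` of all permutation monomials is expensive" would imply the crux.
This file REFUTES it: for every `n ≥ 3` there is a torus-homogeneous `h` (all monomials share the
row sums `R` and the column sums `Cc`) of monotone complexity `≤ 4 n³` whose support contains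
`u + μ_σ` for every `σ ∈ S_n`, and which is nevertheless not a multiple of `per_n`.

Witness (balancing junk along the row `r₀ := 0`).  Put
`t i j := e_{(i,j)} + ∑_{j' ≠ j} e_{(r₀,j')}`, `F i := ∑_j x^{t i j}` and `h := ∏_i F i`,
`u := (n-1) • W` with `W := ∑_j e_{(r₀,j)}` the all-ones row `r₀`.

* margins (`margins_prod`): `t i j` has row sums `[i' = i] + (n-1)[i' = r₀]` and all column sums
  `1` — independent of `j` — so every monomial of `h`, a sum of one term per factor
  (`exists_eq_sum_of_mem_support_prod`), has row sums `R i' = 1 + n(n-1)[i' = r₀]` and column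
  sums `n`;
* cost (`complexity_prod_le`): `x^{t i j}` is a product of `n` variables, so
  `L(h) ≤ n (n² + n) + n ≤ 4 n³`;
* translates (`sum_t_symm_eq`, `sum_t_mem_support`): choosing in factor `i` the term
  `j := σ⁻¹ i` gives `∑_i t i (σ⁻¹ i) = μ_σ + (n-1) • W`, a monomial of `h` (no cancellation over
  `ℝ≥0`, `add_mem_support_mul`);
* not a per-multiple (`not_exists_eq_perPoly_mul`): a monomial of `per_n · g` dominates a
  permutation monomial (`support_mul`, `exists_permMonomial_eq_of_coeff_perPoly_ne_zero`), but the
  monomial `∑_i t i j₀` of the constant choice `j ≡ j₀` has, off column `j₀`, mass only in row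
  `r₀`; a dominated `μ_σ` would send two distinct columns `≠ j₀` (here `n ≥ 3`) to row `r₀`.
-/

noncomputable section

-- `Summit.ValiantsHypothesis.ValiantsHypothesis.…` is the tree's mandated single-conjunct layout
-- (Sub = Summit), so the duplicated namespace component is intended.
set_option linter.dupNamespace false

namespace Summit.ValiantsHypothesis.ValiantsHypothesis.Theorems.DivisionGapPerDivisionHard

open MvPolynomial Literature.Computability.AlgebraicComplexity
open scoped NNReal Pointwise

/-! ### Monomials of products and of sums of monomials over `ℝ≥0` -/

/-- A monomial of a finite product of polynomials is a sum of monomials of the factors.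
[folklore] -/
private theorem exists_eq_sum_of_mem_support_prod {ι τ : Type*} [DecidableEq ι]
    (s : Finset ι) (f : ι → MvPolynomial τ ℝ≥0) {m : τ →₀ ℕ}
    (hm : m ∈ (∏ i ∈ s, f i).support) :
    ∃ v : ι → τ →₀ ℕ, (∀ i ∈ s, v i ∈ (f i).support) ∧ m = ∑ i ∈ s, v i := by
  classical
  induction s using Finset.induction_on generalizing m with
  | empty =>
    refine ⟨fun _ => 0, by simp, ?_⟩
    rw [Finset.prod_empty, mem_support_iff, coeff_one] at hm
    rw [Finset.sum_empty]
    by_contra h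
    exact hm (if_neg (Ne.symm h))
  | insert a s ha ih =>
    rw [Finset.prod_insert ha] at hm
    obtain ⟨x, hx, y, hy, rfl⟩ := Finset.mem_add.1 (support_mul _ _ hm)
    obtain ⟨v, hv, rfl⟩ := ih hy
    refine ⟨Function.update v a x, ?_, ?_⟩
    · intro i hi
      rcases Finset.mem_insert.1 hi with rfl | hi
      · rw [Function.update_self]; exact hx
      · rw [Function.update_of_ne (ne_of_mem_of_not_mem hi ha)]; exact hv i hi
    · rw [Finset.sum_insert ha, Function.update_self]
      congr 1
      exact Finset.sum_congr rfl fun i hi => by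
        rw [Function.update_of_ne (ne_of_mem_of_not_mem hi ha)]

/-- Over `ℝ≥0` (no cancellation) a sum of monomials of the factors is a monomial of the product.
[folklore] -/
private theorem sum_mem_support_prod {ι τ : Type*} [DecidableEq ι]
    (s : Finset ι) (f : ι → MvPolynomial τ ℝ≥0) (v : ι → τ →₀ ℕ)
    (hv : ∀ i ∈ s, v i ∈ (f i).support) : (∑ i ∈ s, v i) ∈ (∏ i ∈ s, f i).support := by
  classical
  induction s using Finset.induction_on with
  | empty =>
    rw [Finset.sum_empty, Finset.prod_empty, mem_support_iff, coeff_one, if_pos rfl]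
    exact one_ne_zero
  | insert a s ha ih =>
    rw [Finset.sum_insert ha, Finset.prod_insert ha]
    exact Literature.Barriers.ValiantsHypothesis.add_mem_support_mul
      (hv a (Finset.mem_insert_self _ _)) (ih fun i hi => hv i (Finset.mem_insert_of_mem hi))

/-- Each exponent `g a` is a monomial of `∑_{i ∈ s} x^{g i}` over `ℝ≥0` (all coefficients are
`≥ 0`, the `a`-th is `1`). [folklore] -/
private theorem mem_support_sum_monomial {ι τ : Type*} (s : Finset ι) (g : ι → τ →₀ ℕ)
    {a : ι} (ha : a ∈ s) : g a ∈ (∑ i ∈ s, monomial (g i) (1 : ℝ≥0)).support := by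
  classical
  rw [mem_support_iff, coeff_sum]
  intro h
  have := (Finset.sum_eq_zero_iff.mp h) a ha
  rw [coeff_monomial, if_pos rfl] at this
  exact one_ne_zero this

/-- The monomials of `∑_{i ∈ s} x^{g i}` are among the `g i`. [folklore] -/
private theorem exists_eq_of_mem_support_sum_monomial {ι τ : Type*} (s : Finset ι)
    (g : ι → τ →₀ ℕ) {m : τ →₀ ℕ} (hm : m ∈ (∑ i ∈ s, monomial (g i) (1 : ℝ≥0)).support) :
    ∃ i ∈ s, m = g i := by
  classical
  rw [mem_support_iff, coeff_sum] at hm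
  by_contra h
  push Not at h
  exact hm (Finset.sum_eq_zero fun i hi => by rw [coeff_monomial, if_neg fun e => h i hi e.symm])

/-- A product of variables is the monomial of the sum of the unit vectors. [folklore] -/
private theorem finsetProd_X_eq_monomial {ι τ : Type*} (s : Finset ι) (c : ι → τ) :
    (∏ x ∈ s, X (c x) : MvPolynomial τ ℝ≥0) = monomial (∑ x ∈ s, Finsupp.single (c x) 1) 1 := by
  rw [monomial_sum_one]
  rfl

/-! ### The balancing-junk witness

Throughout, `r₀` is the junk row and `t i j = e_{(i,j)} + ∑_{j' ≠ j} e_{(r₀,j')}` (hypothesis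
`ht`); the witness is `h = ∏_i ∑_j x^{t i j}`. -/

variable {n : ℕ} (r₀ : Fin n) (t : Fin n → Fin n → (Fin n × Fin n) →₀ ℕ)

/-- Pointwise: `t i j (a, b) = [a = i ∧ b = j] + [a = r₀ ∧ b ≠ j]`. [folklore] -/
private theorem t_apply
    (ht : ∀ i j, t i j = Finsupp.single (i, j) 1 +
      ∑ j' ∈ Finset.univ.erase j, Finsupp.single (r₀, j') 1)
    (i j a b : Fin n) :
    t i j (a, b) = (if a = i ∧ b = j then 1 else 0) + (if a = r₀ ∧ b ≠ j then 1 else 0) := by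
  rw [ht, Finsupp.add_apply, Finsupp.finsetSum_apply]
  simp only [Finsupp.single_apply, Prod.mk.injEq]
  congr 1
  · simp only [eq_comm (a := i) (b := a), eq_comm (a := j) (b := b)]
  · by_cases h1 : a = r₀
    · subst h1
      by_cases h2 : b = j <;> simp [h2]
    · simp [Ne.symm h1, h1]

/-- Row sums of a term: `[a = i] + (n-1)[a = r₀]`. [folklore] -/
private theorem rowSum_t
    (ht : ∀ i j, t i j = Finsupp.single (i, j) 1 +
      ∑ j' ∈ Finset.univ.erase j, Finsupp.single (r₀, j') 1)
    (i j a : Fin n) :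
    ∑ b, t i j (a, b) = (if a = i then 1 else 0) + (if a = r₀ then n - 1 else 0) := by
  simp_rw [t_apply r₀ t ht]
  rw [Finset.sum_add_distrib]
  congr 1
  · by_cases h : a = i <;> simp [h]
  · by_cases h : a = r₀
    · simp only [h, true_and, if_true]
      rw [Finset.sum_boole, Finset.filter_ne', Finset.card_erase_of_mem (Finset.mem_univ j),
        Finset.card_univ, Fintype.card_fin]
      rfl
    · simp [h]

/-- Column sums of a term: all equal to `1` (independently of `j`). [folklore] -/
private theorem colSum_t
    (ht : ∀ i j, t i j = Finsupp.single (i, j) 1 +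
      ∑ j' ∈ Finset.univ.erase j, Finsupp.single (r₀, j') 1)
    (i j b : Fin n) : ∑ a, t i j (a, b) = 1 := by
  simp_rw [t_apply r₀ t ht]
  rw [Finset.sum_add_distrib]
  by_cases h : b = j <;> simp [h]

/-- **Margins.** Every monomial of `h = ∏_i ∑_j x^{t i j}` has row sums `1 + n(n-1)[a = r₀]` and
column sums `n`: it is a sum of one term per factor. [folklore] -/
private theorem margins_prod
    (ht : ∀ i j, t i j = Finsupp.single (i, j) 1 +
      ∑ j' ∈ Finset.univ.erase j, Finsupp.single (r₀, j') 1) :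
    ∀ α ∈ (∏ i, ∑ j, monomial (t i j) (1 : ℝ≥0)).support,
      (∀ a, ∑ b, α (a, b) = 1 + if a = r₀ then n * (n - 1) else 0) ∧ (∀ b, ∑ a, α (a, b) = n) := by
  intro α hα
  obtain ⟨v, hv, rfl⟩ := exists_eq_sum_of_mem_support_prod _ _ hα
  have hJ : ∀ i, ∃ j, v i = t i j := fun i => by
    obtain ⟨j, -, hj⟩ := exists_eq_of_mem_support_sum_monomial _ _ (hv i (Finset.mem_univ i))
    exact ⟨j, hj⟩
  choose J hJ using hJ
  simp only [Finsupp.finsetSum_apply, hJ]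
  refine ⟨fun a => ?_, fun b => ?_⟩
  · rw [Finset.sum_comm]
    simp_rw [rowSum_t r₀ t ht]
    rw [Finset.sum_add_distrib, Finset.sum_ite_eq, if_pos (Finset.mem_univ _), Finset.sum_const,
      Finset.card_univ, Fintype.card_fin, smul_eq_mul]
    split_ifs <;> simp
  · rw [Finset.sum_comm]
    simp_rw [colSum_t r₀ t ht]
    simp

/-- **Translates.** Choosing the term `j := σ⁻¹ i` in factor `i`:
`∑_i t i (σ⁻¹ i) = (n-1) • W + μ_σ` with `W` the all-ones row `r₀` (add `W` to both sides and
reindex by `σ`). [folklore] -/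
private theorem sum_t_symm_eq
    (ht : ∀ i j, t i j = Finsupp.single (i, j) 1 +
      ∑ j' ∈ Finset.univ.erase j, Finsupp.single (r₀, j') 1)
    (hn : 1 ≤ n) (σ : Equiv.Perm (Fin n)) :
    ∑ i, t i (σ.symm i) = (n - 1) • (∑ j, Finsupp.single (r₀, j) 1) + permMonomial σ := by
  set W : (Fin n × Fin n) →₀ ℕ := ∑ j, Finsupp.single (r₀, j) 1 with hW
  have key : ∀ i j, t i j + Finsupp.single (r₀, j) 1 = Finsupp.single (i, j) 1 + W := fun i j => by
    rw [ht, add_assoc, Finset.sum_erase_add _ _ (Finset.mem_univ j)]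
  have h1 : ∑ i, Finsupp.single (r₀, σ.symm i) (1 : ℕ) = W :=
    Equiv.sum_comp σ.symm (fun j => Finsupp.single (r₀, j) (1 : ℕ))
  have h2 : ∑ i, Finsupp.single (i, σ.symm i) (1 : ℕ) = permMonomial σ := by
    rw [permMonomial]
    refine (Equiv.sum_comp σ (fun i => Finsupp.single (i, σ.symm i) (1 : ℕ))).symm.trans ?_
    simp only [Equiv.symm_apply_apply]
  have hnW : n • W = (n - 1) • W + W := by
    rw [← succ_nsmul, Nat.sub_add_cancel hn]
  apply add_right_cancel (b := W)
  calc ∑ i, t i (σ.symm i) + W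
      = ∑ i, (t i (σ.symm i) + Finsupp.single (r₀, σ.symm i) 1) := by
        rw [Finset.sum_add_distrib, h1]
    _ = ∑ i, (Finsupp.single (i, σ.symm i) 1 + W) := Finset.sum_congr rfl fun i _ => key i _
    _ = permMonomial σ + n • W := by
        rw [Finset.sum_add_distrib, h2, Finset.sum_const, Finset.card_univ, Fintype.card_fin]
    _ = (n - 1) • W + permMonomial σ + W := by rw [hnW]; abel

/-- Every choice `J` of one term per factor gives a monomial `∑_i t i (J i)` of `h` (no
cancellation over `ℝ≥0`). [folklore] -/
private theorem sum_t_mem_support (J : Fin n → Fin n) :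
    ∑ i, t i (J i) ∈ (∏ i, ∑ j, monomial (t i j) (1 : ℝ≥0)).support :=
  sum_mem_support_prod _ _ _ fun i _ => mem_support_sum_monomial _ (t i) (Finset.mem_univ (J i))

/-- **Not a per-multiple.** A monomial of `per_n · g` dominates a permutation monomial; the
monomial `∑_i t i j₀` of `h` has, off column `j₀`, mass only in row `r₀`, so a dominated `μ_σ`
sends the two columns `1, 2 ≠ j₀ = 0` both to row `r₀`. [folklore] -/
private theorem not_exists_eq_perPoly_mul
    (ht : ∀ i j, t i j = Finsupp.single (i, j) 1 +
      ∑ j' ∈ Finset.univ.erase j, Finsupp.single (r₀, j') 1)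
    (hn : 3 ≤ n) :
    ¬ ∃ g : MvPolynomial (Fin n × Fin n) ℝ≥0,
      (∏ i, ∑ j, monomial (t i j) (1 : ℝ≥0)) = perPoly (Fin n) ℝ≥0 * g := by
  rintro ⟨g, hg⟩
  set j₀ : Fin n := ⟨0, by omega⟩ with hj₀
  have hmem := sum_t_mem_support t fun _ => j₀
  rw [hg] at hmem
  obtain ⟨d, hd, β, -, he⟩ := Finset.mem_add.mp (support_mul _ _ hmem)
  obtain ⟨σ, rfl⟩ :=
    exists_permMonomial_eq_of_coeff_perPoly_ne_zero ℝ≥0 (mem_support_iff.mp hd)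
  -- every column other than `j₀` is sent to the junk row `r₀`
  have hcol : ∀ b, b ≠ j₀ → σ b = r₀ := by
    intro b hb
    by_contra hσ
    have h1 := DFunLike.congr_fun he (σ b, b)
    rw [Finsupp.add_apply, permMonomial_apply, if_pos rfl, Finsupp.finsetSum_apply] at h1
    simp_rw [t_apply r₀ t ht] at h1
    simp [hb, hσ] at h1
  have h1 := hcol ⟨1, by omega⟩ (by simp [hj₀])
  have h2 := hcol ⟨2, by omega⟩ (by simp [hj₀])
  have := σ.injective (h1.trans h2.symm)
  simp at this

/-- **Cost.** `x^{t i j}` is a product of `n` variables (`n` gates), so `L(∑_j x^{t i j}) ≤ n² + n`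
and `L(h) ≤ n (n² + n) + n ≤ 4 n³` (variables are free, one gate per `+`/`·`). [folklore] -/
private theorem complexity_prod_le
    (ht : ∀ i j, t i j = Finsupp.single (i, j) 1 +
      ∑ j' ∈ Finset.univ.erase j, Finsupp.single (r₀, j') 1)
    (hn : 1 ≤ n) : complexity (∏ i, ∑ j, monomial (t i j) (1 : ℝ≥0)) ≤ 4 * n ^ 3 := by
  have hX0 : ∀ v : Fin n × Fin n, complexity (X v : MvPolynomial (Fin n × Fin n) ℝ≥0) = 0 :=
    fun v => complexity_X_holds v
  have hterm : ∀ i j, complexity (monomial (t i j) (1 : ℝ≥0)) ≤ n := by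
    intro i j
    have hX : monomial (t i j) (1 : ℝ≥0) = X (i, j) * ∏ j' ∈ Finset.univ.erase j, X (r₀, j') := by
      rw [finsetProd_X_eq_monomial, X, monomial_mul, one_mul, ht]
    rw [hX]
    calc complexity (X (i, j) * ∏ j' ∈ Finset.univ.erase j, X (r₀, j'))
        ≤ complexity (X (i, j) : MvPolynomial _ ℝ≥0) +
            complexity (∏ j' ∈ Finset.univ.erase j, (X (r₀, j') : MvPolynomial _ ℝ≥0)) + 1 :=
          complexity_mul_le_holds _ _
      _ ≤ 0 + (∑ j' ∈ Finset.univ.erase j, complexity (X (r₀, j') : MvPolynomial _ ℝ≥0) +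
            (Finset.univ.erase j).card) + 1 :=
          Nat.add_le_add_right (Nat.add_le_add (hX0 _).le (complexity_finset_prod_le _ _)) 1
      _ = n := by
          rw [Finset.sum_eq_zero (fun j' _ => hX0 _), Finset.card_erase_of_mem (Finset.mem_univ j),
            Finset.card_univ, Fintype.card_fin]
          omega
  have hF : ∀ i, complexity (∑ j, monomial (t i j) (1 : ℝ≥0)) ≤ n * n + n := fun i =>
    calc complexity (∑ j, monomial (t i j) (1 : ℝ≥0))
        ≤ ∑ j, complexity (monomial (t i j) (1 : ℝ≥0)) + (Finset.univ : Finset (Fin n)).card :=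
          complexity_finset_sum_le _ _
      _ ≤ ∑ _j : Fin n, n + (Finset.univ : Finset (Fin n)).card :=
          Nat.add_le_add_right (Finset.sum_le_sum fun j _ => hterm i j) _
      _ = n * n + n := by simp
  calc complexity (∏ i, ∑ j, monomial (t i j) (1 : ℝ≥0))
      ≤ ∑ i, complexity (∑ j, monomial (t i j) (1 : ℝ≥0)) + (Finset.univ : Finset (Fin n)).card :=
        complexity_finset_prod_le _ _
    _ ≤ ∑ _i : Fin n, (n * n + n) + (Finset.univ : Finset (Fin n)).card :=
        Nat.add_le_add_right (Finset.sum_le_sum fun i _ => hF i) _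
    _ = n * (n * n + n) + n := by simp
    _ ≤ 4 * n ^ 3 := by nlinarith [Nat.le_mul_self n]

/-- **Translates of `S_n` are cheap inside a torus class (negative lemma of line
`pair-descent-jss-endpoint`).** For every `n ≥ 3` there are a torus-homogeneous
`h ∈ ℝ≥0[x_ij]` (all monomials have row sums `R` and column sums `Cc`) with `L(h) ≤ 4 n³`, and a
vector `u`, such that `u + μ_σ ∈ supp h` for every permutation `σ`, while `h` is not a multiple
of `per_n`.  Witness: the balancing junk `h = ∏_i ∑_j x_{ij} ∏_{j' ≠ j} x_{r₀ j'}`,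
`u = (n-1) • (row r₀)` (`margins_prod`, `complexity_prod_le`, `sum_t_symm_eq`,
`not_exists_eq_perPoly_mul`). [folklore] -/
theorem stub_translateCheap :
    ∀ n : ℕ, 3 ≤ n →
      ∃ (h : MvPolynomial (Fin n × Fin n) ℝ≥0) (u : (Fin n × Fin n) →₀ ℕ) (R Cc : Fin n → ℕ),
        (∀ α ∈ h.support, (∀ i, ∑ j, α (i, j) = R i) ∧ (∀ j, ∑ i, α (i, j) = Cc j)) ∧
        complexity h ≤ 4 * n ^ 3 ∧
        (∀ σ : Equiv.Perm (Fin n), u + permMonomial σ ∈ h.support) ∧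
        ¬ ∃ g : MvPolynomial (Fin n × Fin n) ℝ≥0, h = perPoly (Fin n) ℝ≥0 * g := by
  intro n hn
  -- the junk row `r₀` and the term exponents `t i j = e_{(i,j)} + ∑_{j' ≠ j} e_{(r₀,j')}`
  obtain ⟨r₀⟩ : Nonempty (Fin n) := ⟨⟨0, by omega⟩⟩
  obtain ⟨t, ht⟩ : ∃ t : Fin n → Fin n → (Fin n × Fin n) →₀ ℕ, ∀ i j,
      t i j = Finsupp.single (i, j) 1 + ∑ j' ∈ Finset.univ.erase j, Finsupp.single (r₀, j') 1 :=
    ⟨_, fun _ _ => rfl⟩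
  refine ⟨∏ i, ∑ j, monomial (t i j) (1 : ℝ≥0), (n - 1) • ∑ j, Finsupp.single (r₀, j) 1,
    fun a => 1 + if a = r₀ then n * (n - 1) else 0, fun _ => n, margins_prod r₀ t ht,
    complexity_prod_le r₀ t ht (by omega), fun σ => ?_, not_exists_eq_perPoly_mul r₀ t ht hn⟩
  rw [← sum_t_symm_eq r₀ t ht (by omega) σ]
  exact sum_t_mem_support t _

end Summit.ValiantsHypothesis.ValiantsHypothesis.Theorems.DivisionGapPerDivisionHard

end
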